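import Literature.Probability.LatticeModels.SRWIntersectionSums
import Literature.Probability.LatticeModels.SRWPathSpace
import HarnessLib

/-!
# Variance of the number of self-intersections of the simple random walk in a window:
# the combinatorial reduction

Companion to `SRWPathSpace.lean` (pair probabilities of the self-intersection events
`inter i j = {S_i = S_j}`) and `SRWIntersectionSums.lean` (the lattice sums `tau`, the nested
sum). For the window of vertices `[0, 2n)` and the "upper pairs"
`upperPairs n = {(i,j) : i < n, i < j < 2n}` (the pairs read by the block-pair functional of the
weakly self-avoiding walk), the variance of the number of self-intersections
`N = Σ_{p ∈ upperPairs n} 𝟙{X_p}` is `varSum d n = Σ_{p,p'} (P(X_p ∩ X_p') - P(X_p) P(X_p'))`, and the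
overlapping part of the second moment is `ovSum d n = Σ_{p,p' overlapping} P(X_p ∩ X_p')`.
This file classifies the pairs of pairs (identical / sharing one vertex / separated / interlaced /
nested) and reduces both sums to the parametrised sums bounded in the companion file
`SRWIntersectionVarianceBounds.lean` (Lawler 1991, §1 and §6.4 for the planar analogue; here all
`d`, the dimension enters only through the bounds):

* `upperPairs`, `pairProb`, `pairProb₂`, `Overlap`, `ovSum`, `varSum`, `cov`, `covBound`,
  `interTerm`, `nestTerm`;
* `cov_le_covBound` — the pointwise classification bound (eleven cases);
* `varSum_le`, `ovSum_le` — the reductions to parametrised sums.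

All folklore, fully proved.
-/

noncomputable section

open MeasureTheory Finset

namespace Literature.Probability.LatticeModels

namespace SRW

variable {d : ℕ}

/-! ### The sums -/

/-- The upper pairs of the window: `{(i,j) : i < n, i < j < 2n}`. [folklore] -/
def upperPairs (n : ℕ) : Finset (ℕ × ℕ) :=
  ((Finset.range n) ×ˢ (Finset.range (2 * n))).filter fun p => p.1 < p.2

/-- Membership in `upperPairs`. [folklore] -/
theorem mem_upperPairs {n : ℕ} {p : ℕ × ℕ} : p ∈ upperPairs n ↔ p.1 < n ∧ p.2 < 2 * n ∧ p.1 < p.2 := by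
  simp only [upperPairs, Finset.mem_filter, Finset.mem_product, Finset.mem_range]
  tauto

/-- `P(X_p) = P(S_i = S_j)`. [folklore] -/
def pairProb (d : ℕ) [NeZero d] (p : ℕ × ℕ) : ℝ := (pathLaw d).real (inter p.1 p.2)

/-- `P(X_p ∩ X_{p'})`. [folklore] -/
def pairProb₂ (d : ℕ) [NeZero d] (p p' : ℕ × ℕ) : ℝ := (pathLaw d).real (inter p.1 p.2 ∩ inter p'.1 p'.2)

/-- Two pairs overlap if they share a vertex. [folklore] -/
def Overlap (p p' : ℕ × ℕ) : Prop := p.1 = p'.1 ∨ p.1 = p'.2 ∨ p.2 = p'.1 ∨ p.2 = p'.2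

/-- `Overlap` is decidable. [folklore] -/
instance (p p' : ℕ × ℕ) : Decidable (Overlap p p') := by unfold Overlap; infer_instance

/-- The overlapping part of the second moment: `Σ_{p,p' overlapping} P(X_p ∩ X_{p'})`. [folklore] -/
def ovSum (d : ℕ) [NeZero d] (n : ℕ) : ℝ :=
  ∑ p ∈ upperPairs n, ∑ p' ∈ upperPairs n, if Overlap p p' then pairProb₂ d p p' else 0

/-- The variance of the number of self-intersections among the upper pairs:
`Σ_{p,p'} (P(X_p ∩ X_{p'}) - P(X_p) P(X_{p'}))`. [folklore] -/
def varSum (d : ℕ) [NeZero d] (n : ℕ) : ℝ :=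
  ∑ p ∈ upperPairs n, ∑ p' ∈ upperPairs n, (pairProb₂ d p p' - pairProb d p * pairProb d p')

/-- `P(X_p) = p_{j-i}(0)` on upper pairs. [folklore] -/
theorem pairProb_eq [NeZero d] {p : ℕ × ℕ} (hp : p.1 < p.2) : pairProb d p = prob d (p.2 - p.1) 0 :=
  real_inter hp.le

/-- `pairProb ≥ 0`. [folklore] -/
theorem pairProb_nonneg [NeZero d] (p : ℕ × ℕ) : 0 ≤ pairProb d p := measureReal_nonneg

/-- `pairProb₂ ≥ 0`. [folklore] -/
theorem pairProb₂_nonneg [NeZero d] (p p' : ℕ × ℕ) : 0 ≤ pairProb₂ d p p' := measureReal_nonneg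

/-- `pairProb₂` is symmetric. [folklore] -/
theorem pairProb₂_comm [NeZero d] (p p' : ℕ × ℕ) : pairProb₂ d p p' = pairProb₂ d p' p := by
  unfold pairProb₂; rw [Set.inter_comm]

/-- `pairProb₂ p p' ≤ pairProb p`. [folklore] -/
theorem pairProb₂_le_left [NeZero d] (p p' : ℕ × ℕ) : pairProb₂ d p p' ≤ pairProb d p :=
  measureReal_mono Set.inter_subset_left

/-! ### The parametrised terms -/

/-- The interlaced term for `i < k < j < l`: `Σ_{y ∈ box (j-k)} p_{k-i}(y) p_{j-k}(y) p_{l-j}(y)`.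
[folklore] -/
def interTerm (d : ℕ) (i k j l : ℕ) : ℝ :=
  ∑ y ∈ box d (j - k), prob d (k - i) y * prob d (j - k) y * prob d (l - j) y

/-- The nested term for `i < k < l < j`: `p_{l-k}(0) (p_{(k-i)+(j-l)}(0) - p_{j-i}(0))`. [folklore] -/
def nestTerm (d : ℕ) (i k l j : ℕ) : ℝ :=
  prob d (l - k) 0 * (prob d (k - i + (j - l)) 0 - prob d (j - i) 0)

/-- `interTerm ≥ 0`. [folklore] -/
theorem interTerm_nonneg (i k j l : ℕ) : 0 ≤ interTerm d i k j l :=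
  Finset.sum_nonneg fun y _ => by
    have := prob_nonneg (d := d) (k - i) y; have := prob_nonneg (d := d) (j - k) y
    have := prob_nonneg (d := d) (l - j) y; positivity

/-! ### The pointwise classification -/

/-- The covariance of `X_p` and `X_{p'}`. [folklore] -/
def cov (d : ℕ) [NeZero d] (p p' : ℕ × ℕ) : ℝ := pairProb₂ d p p' - pairProb d p * pairProb d p'

/-- The classification bound for a pair of upper pairs `p = (i,j)`, `p' = (k,l)`:
identical, sharing one vertex, separated (zero), interlaced (two orientations), nested (two
orientations). [folklore] -/
def covBound (d : ℕ) [NeZero d] (p p' : ℕ × ℕ) : ℝ :=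
  (if Overlap p p' then pairProb₂ d p p' else 0) +
    ((if p.1 < p'.1 ∧ p'.1 < p.2 ∧ p.2 < p'.2 then interTerm d p.1 p'.1 p.2 p'.2 else 0) +
      (if p'.1 < p.1 ∧ p.1 < p'.2 ∧ p'.2 < p.2 then interTerm d p'.1 p.1 p'.2 p.2 else 0)) +
    ((if p.1 < p'.1 ∧ p'.2 < p.2 then nestTerm d p.1 p'.1 p'.2 p.2 else 0) +
      (if p'.1 < p.1 ∧ p.2 < p'.2 then nestTerm d p'.1 p.1 p.2 p'.2 else 0))

/-- **The pointwise classification**: `cov p p' ≤ covBound p p'` for upper pairs. [folklore] -/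
theorem cov_le_covBound [NeZero d] {n : ℕ} {p p' : ℕ × ℕ} (hp : p ∈ upperPairs n) (hp' : p' ∈ upperPairs n) :
    cov d p p' ≤ covBound d p p' := by
  obtain ⟨i, j⟩ := p
  obtain ⟨k, l⟩ := p'
  rw [mem_upperPairs] at hp hp'
  simp only at hp hp'
  obtain ⟨_, _, hij⟩ := hp
  obtain ⟨_, _, hkl⟩ := hp'
  unfold cov covBound
  simp only
  by_cases hov : Overlap (i, j) (k, l)
  · -- overlapping: cov ≤ P(X_p ∩ X_p')
    rw [if_pos hov]
    have h1 : pairProb₂ d (i, j) (k, l) - pairProb d (i, j) * pairProb d (k, l) ≤ pairProb₂ d (i, j) (k, l) := by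
      have := mul_nonneg (pairProb_nonneg (d := d) (i, j)) (pairProb_nonneg (d := d) (k, l)); linarith
    refine h1.trans ?_
    have hI : 0 ≤ (if i < k ∧ k < j ∧ j < l then interTerm d i k j l else 0) +
        (if k < i ∧ i < l ∧ l < j then interTerm d k i l j else 0) := by
      refine add_nonneg ?_ ?_ <;> split_ifs <;> first | exact interTerm_nonneg _ _ _ _ | exact le_rfl
    have hN : 0 ≤ (if i < k ∧ l < j then nestTerm d i k l j else 0) + (if k < i ∧ j < l then nestTerm d k i j l else 0) := by
      unfold Overlap at hov; simp only at hov
      refine add_nonneg ?_ ?_ <;> split_ifs with h <;> first | exact le_rfl | (exfalso; omega)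
    linarith
  · rw [if_neg hov]
    unfold Overlap at hov
    simp only [not_or] at hov
    obtain ⟨hik, hil, hjk, hjl⟩ := hov
    -- the vertices are pairwise distinct: classify the relative position
    rcases Nat.lt_or_gt_of_ne hik with hik' | hki'
    · -- i < k
      rcases Nat.lt_or_gt_of_ne hjk with hjk' | hkj'
      · -- i < j < k < l : separated
        have hsep : pairProb₂ d (i, j) (k, l) = pairProb d (i, j) * pairProb d (k, l) :=
          real_inter_inter_separated hij.le hjk'.le hkl.le
        rw [if_neg (by omega), if_neg (by omega), if_neg (by omega), if_neg (by omega), hsep]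
        simp
      · -- i < k < j
        rcases Nat.lt_or_gt_of_ne hjl with hjl' | hlj'
        · -- i < k < j < l : interlaced
          have hint : pairProb₂ d (i, j) (k, l) = interTerm d i k j l :=
            real_inter_inter_interlaced hik'.le hkj'.le hjl'.le
          rw [if_pos ⟨hik', hkj', hjl'⟩, if_neg (by omega), if_neg (by omega), if_neg (by omega), hint]
          have := mul_nonneg (pairProb_nonneg (d := d) (i, j)) (pairProb_nonneg (d := d) (k, l))
          simp only [zero_add, add_zero]
          linarith
        · -- i < k < l < j : nested (p' inside p)
          have hnest : pairProb₂ d (i, j) (k, l) = prob d (l - k) 0 * prob d (k - i + (j - l)) 0 :=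
            real_inter_inter_nested hik'.le hkl.le hlj'.le
          rw [if_neg (by omega), if_neg (by omega), if_pos ⟨hik', hlj'⟩, if_neg (by omega), hnest,
            pairProb_eq hij, pairProb_eq hkl, nestTerm]
          simp only
          ring_nf
          linarith
    · -- k < i
      rcases Nat.lt_or_gt_of_ne hil with hil' | hli'
      · -- k < i < l
        rcases Nat.lt_or_gt_of_ne hjl with hjl' | hlj'
        · -- k < i < j < l : nested (p inside p')
          have hnest : pairProb₂ d (i, j) (k, l) = prob d (j - i) 0 * prob d (i - k + (l - j)) 0 := by
            rw [pairProb₂_comm]; exact real_inter_inter_nested hki'.le hij.le hjl'.le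
          rw [if_neg (by omega), if_neg (by omega), if_neg (by omega), if_pos ⟨hki', hjl'⟩, hnest,
            pairProb_eq hij, pairProb_eq hkl, nestTerm]
          simp only
          ring_nf
          linarith
        · -- k < i < l < j : interlaced (other orientation)
          have hint : pairProb₂ d (i, j) (k, l) = interTerm d k i l j := by
            rw [pairProb₂_comm]; exact real_inter_inter_interlaced hki'.le hil'.le hlj'.le
          rw [if_neg (by omega), if_pos ⟨hki', hil', hlj'⟩, if_neg (by omega), if_neg (by omega), hint]
          have := mul_nonneg (pairProb_nonneg (d := d) (i, j)) (pairProb_nonneg (d := d) (k, l))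
          simp only [zero_add, add_zero]
          linarith
      · -- k < l < i < j : separated
        have hsep : pairProb₂ d (i, j) (k, l) = pairProb d (i, j) * pairProb d (k, l) := by
          rw [pairProb₂_comm, mul_comm]; exact real_inter_inter_separated hkl.le hli'.le hij.le
        rw [if_neg (by omega), if_neg (by omega), if_neg (by omega), if_neg (by omega), hsep]
        simp

/-- **Reduction of the variance sum**: `varSum ≤ ovSum + (interlaced sums) + (nested sums)`.
[folklore] -/
theorem varSum_le [NeZero d] (n : ℕ) :
    varSum d n ≤ ovSum d n +
      (∑ p ∈ upperPairs n, ∑ p' ∈ upperPairs n,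
        ((if p.1 < p'.1 ∧ p'.1 < p.2 ∧ p.2 < p'.2 then interTerm d p.1 p'.1 p.2 p'.2 else 0) +
          (if p'.1 < p.1 ∧ p.1 < p'.2 ∧ p'.2 < p.2 then interTerm d p'.1 p.1 p'.2 p.2 else 0))) +
      ∑ p ∈ upperPairs n, ∑ p' ∈ upperPairs n,
        ((if p.1 < p'.1 ∧ p'.2 < p.2 then nestTerm d p.1 p'.1 p'.2 p.2 else 0) +
          (if p'.1 < p.1 ∧ p.2 < p'.2 then nestTerm d p'.1 p.1 p.2 p'.2 else 0)) := by
  unfold varSum ovSum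
  rw [← Finset.sum_add_distrib, ← Finset.sum_add_distrib]
  refine Finset.sum_le_sum fun p hp => ?_
  rw [← Finset.sum_add_distrib, ← Finset.sum_add_distrib]
  refine Finset.sum_le_sum fun p' hp' => ?_
  have h := cov_le_covBound (d := d) hp hp'
  unfold cov covBound at h
  linarith

/-- **Reduction of the overlap sum**: overlapping upper pairs are identical or share exactly one
vertex, in one of four patterns; `P(X_p ∩ X_p')` is then `P(X_p)` resp. a chain probability
`p_{β-α}(0) p_{γ-β}(0)`. [folklore] -/
theorem ovSum_le [NeZero d] (n : ℕ) :
    ovSum d n ≤ (∑ p ∈ upperPairs n, pairProb d p) +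
      ∑ p ∈ upperPairs n, ∑ p' ∈ upperPairs n,
        ((if p.1 = p'.1 ∧ p.2 < p'.2 then prob d (p.2 - p.1) 0 * prob d (p'.2 - p.2) 0 else 0) +
         (if p.1 = p'.1 ∧ p'.2 < p.2 then prob d (p'.2 - p.1) 0 * prob d (p.2 - p'.2) 0 else 0) +
         (if p.2 = p'.2 ∧ p.1 < p'.1 then prob d (p'.1 - p.1) 0 * prob d (p.2 - p'.1) 0 else 0) +
         (if p.2 = p'.2 ∧ p'.1 < p.1 then prob d (p.1 - p'.1) 0 * prob d (p.2 - p.1) 0 else 0) +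
         (if p.2 = p'.1 then prob d (p.2 - p.1) 0 * prob d (p'.2 - p.2) 0 else 0) +
         (if p.1 = p'.2 then prob d (p.1 - p'.1) 0 * prob d (p.2 - p.1) 0 else 0)) := by
  classical
  unfold ovSum
  have hid : ∑ p ∈ upperPairs n, pairProb d p = ∑ p ∈ upperPairs n, ∑ p' ∈ upperPairs n,
      if p = p' then pairProb₂ d p p' else 0 := by
    refine Finset.sum_congr rfl fun p hp => ?_
    rw [Finset.sum_ite_eq, if_pos hp]
    unfold pairProb pairProb₂; rw [Set.inter_self]
  rw [hid, ← Finset.sum_add_distrib]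
  refine Finset.sum_le_sum fun p hp => ?_
  rw [← Finset.sum_add_distrib]
  refine Finset.sum_le_sum fun p' hp' => ?_
  obtain ⟨i, j⟩ := p
  obtain ⟨k, l⟩ := p'
  rw [mem_upperPairs] at hp hp'
  simp only at hp hp' ⊢
  obtain ⟨_, _, hij⟩ := hp
  obtain ⟨_, _, hkl⟩ := hp'
  by_cases hov : Overlap (i, j) (k, l)
  swap
  · rw [if_neg hov]
    have h0 : 0 ≤ (if ((i, j) : ℕ × ℕ) = (k, l) then pairProb₂ d (i, j) (k, l) else 0) := by
      split_ifs <;> first | exact pairProb₂_nonneg _ _ | exact le_rfl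
    have hnn : ∀ (q : Prop) [Decidable q] (x : ℝ), 0 ≤ x → 0 ≤ (if q then x else 0) := by
      intro q _ x hx; split_ifs <;> [exact hx; exact le_rfl]
    have := prob_nonneg (d := d)
    nlinarith [hnn (i = k ∧ j < l) _ (mul_nonneg (this (j - i) 0) (this (l - j) 0)),
      hnn (i = k ∧ l < j) _ (mul_nonneg (this (l - i) 0) (this (j - l) 0)),
      hnn (j = l ∧ i < k) _ (mul_nonneg (this (k - i) 0) (this (j - k) 0)),
      hnn (j = l ∧ k < i) _ (mul_nonneg (this (i - k) 0) (this (j - i) 0)),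
      hnn (j = k) _ (mul_nonneg (this (j - i) 0) (this (l - j) 0)),
      hnn (i = l) _ (mul_nonneg (this (i - k) 0) (this (j - i) 0)), h0]
  rw [if_pos hov]
  unfold Overlap at hov
  simp only at hov
  have hnn : ∀ (q : Prop) [Decidable q] (x : ℝ), 0 ≤ x → 0 ≤ (if q then x else 0) := by
    intro q _ x hx; split_ifs <;> [exact hx; exact le_rfl]
  have hp0 := prob_nonneg (d := d)
  -- case analysis on the overlap pattern
  by_cases heq : i = k ∧ j = l
  · obtain ⟨rfl, rfl⟩ := heq
    rw [if_pos rfl]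
    nlinarith [hnn (i = i ∧ j < j) _ (mul_nonneg (hp0 (j - i) 0) (hp0 (j - j) 0)),
      hnn (i = i ∧ j < j) _ (mul_nonneg (hp0 (j - i) 0) (hp0 (j - j) 0)),
      hnn (j = j ∧ i < i) _ (mul_nonneg (hp0 (i - i) 0) (hp0 (j - i) 0)),
      hnn (j = j ∧ i < i) _ (mul_nonneg (hp0 (i - i) 0) (hp0 (j - i) 0)),
      hnn (j = i) _ (mul_nonneg (hp0 (j - i) 0) (hp0 (j - j) 0)),
      hnn (i = j) _ (mul_nonneg (hp0 (i - i) 0) (hp0 (j - i) 0))]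
  · rw [if_neg (show ((i, j) : ℕ × ℕ) ≠ (k, l) from fun h => heq (Prod.mk.inj h))]
    -- exactly one shared vertex: compute P(X_p ∩ X_p') as a chain probability, then compare
    have key : ∀ (x : ℝ) (c₁ c₂ c₃ c₄ c₅ c₆ : Prop) [Decidable c₁] [Decidable c₂] [Decidable c₃] [Decidable c₄]
        [Decidable c₅] [Decidable c₆] (t₁ t₂ t₃ t₄ t₅ t₆ : ℝ),
        0 ≤ t₁ → 0 ≤ t₂ → 0 ≤ t₃ → 0 ≤ t₄ → 0 ≤ t₅ → 0 ≤ t₆ →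
        ((c₁ ∧ x = t₁) ∨ (c₂ ∧ x = t₂) ∨ (c₃ ∧ x = t₃) ∨ (c₄ ∧ x = t₄) ∨ (c₅ ∧ x = t₅) ∨ (c₆ ∧ x = t₆)) →
        x ≤ 0 + ((if c₁ then t₁ else 0) + (if c₂ then t₂ else 0) + (if c₃ then t₃ else 0) +
          (if c₄ then t₄ else 0) + (if c₅ then t₅ else 0) + (if c₆ then t₆ else 0)) := by
      intro x c₁ c₂ c₃ c₄ c₅ c₆ _ _ _ _ _ _ t₁ t₂ t₃ t₄ t₅ t₆ h₁ h₂ h₃ h₄ h₅ h₆ hx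
      have g₁ : (c₁ → t₁ ≤ (if c₁ then t₁ else 0)) ∧ 0 ≤ (if c₁ then t₁ else 0) := by split_ifs <;> simp_all
      have g₂ : (c₂ → t₂ ≤ (if c₂ then t₂ else 0)) ∧ 0 ≤ (if c₂ then t₂ else 0) := by split_ifs <;> simp_all
      have g₃ : (c₃ → t₃ ≤ (if c₃ then t₃ else 0)) ∧ 0 ≤ (if c₃ then t₃ else 0) := by split_ifs <;> simp_all
      have g₄ : (c₄ → t₄ ≤ (if c₄ then t₄ else 0)) ∧ 0 ≤ (if c₄ then t₄ else 0) := by split_ifs <;> simp_all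
      have g₅ : (c₅ → t₅ ≤ (if c₅ then t₅ else 0)) ∧ 0 ≤ (if c₅ then t₅ else 0) := by split_ifs <;> simp_all
      have g₆ : (c₆ → t₆ ≤ (if c₆ then t₆ else 0)) ∧ 0 ≤ (if c₆ then t₆ else 0) := by split_ifs <;> simp_all
      rcases hx with ⟨hc, rfl⟩ | ⟨hc, rfl⟩ | ⟨hc, rfl⟩ | ⟨hc, rfl⟩ | ⟨hc, rfl⟩ | ⟨hc, rfl⟩
      · linarith [g₁.1 hc, g₂.2, g₃.2, g₄.2, g₅.2, g₆.2]
      · linarith [g₂.1 hc, g₁.2, g₃.2, g₄.2, g₅.2, g₆.2]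
      · linarith [g₃.1 hc, g₁.2, g₂.2, g₄.2, g₅.2, g₆.2]
      · linarith [g₄.1 hc, g₁.2, g₂.2, g₃.2, g₅.2, g₆.2]
      · linarith [g₅.1 hc, g₁.2, g₂.2, g₃.2, g₄.2, g₆.2]
      · linarith [g₆.1 hc, g₁.2, g₂.2, g₃.2, g₄.2, g₅.2]
    refine key (pairProb₂ d (i, j) (k, l)) _ _ _ _ _ _ _ _ _ _ _ _
      (mul_nonneg (hp0 _ _) (hp0 _ _)) (mul_nonneg (hp0 _ _) (hp0 _ _)) (mul_nonneg (hp0 _ _) (hp0 _ _))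
      (mul_nonneg (hp0 _ _) (hp0 _ _)) (mul_nonneg (hp0 _ _) (hp0 _ _)) (mul_nonneg (hp0 _ _) (hp0 _ _)) ?_
    rcases hov with hik | hil | hjk | hjl
    · -- i = k, j ≠ l
      subst hik
      have hjl : j ≠ l := fun h => heq ⟨rfl, h⟩
      rcases Nat.lt_or_gt_of_ne hjl with h | h
      · refine Or.inl ⟨⟨rfl, h⟩, ?_⟩
        unfold pairProb₂; simp only
        rw [inter_ab_inter_ac, real_inter_inter_chain hij.le h.le]
      · refine Or.inr (Or.inl ⟨⟨rfl, h⟩, ?_⟩)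
        unfold pairProb₂; simp only
        rw [Set.inter_comm, inter_ab_inter_ac, real_inter_inter_chain hkl.le h.le]
    · -- i = l : k < l = i < j
      subst hil
      refine Or.inr (Or.inr (Or.inr (Or.inr (Or.inr ⟨rfl, ?_⟩))))
      unfold pairProb₂; simp only
      rw [Set.inter_comm, real_inter_inter_chain hkl.le hij.le]
    · -- j = k : i < j = k < l
      subst hjk
      refine Or.inr (Or.inr (Or.inr (Or.inr (Or.inl ⟨rfl, ?_⟩))))
      unfold pairProb₂; simp only
      rw [real_inter_inter_chain hij.le hkl.le]
    · -- j = l, i ≠ k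
      subst hjl
      have hik : i ≠ k := fun h => heq ⟨h, rfl⟩
      rcases Nat.lt_or_gt_of_ne hik with h | h
      · refine Or.inr (Or.inr (Or.inl ⟨⟨rfl, h⟩, ?_⟩))
        unfold pairProb₂; simp only
        rw [inter_ac_inter_bc, real_inter_inter_chain h.le hkl.le]
      · refine Or.inr (Or.inr (Or.inr (Or.inl ⟨⟨rfl, h⟩, ?_⟩)))
        unfold pairProb₂; simp only
        rw [Set.inter_comm, inter_ac_inter_bc, real_inter_inter_chain h.le hij.le]

end SRW

end Literature.Probability.LatticeModels
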